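import Summits.NavierStokesRegularity.NavierStokesRegularity.Theses.TypeICertificateLadder
import Summits.NavierStokesRegularity.NavierStokesRegularity.Theorems.RungReynoldsOne.Negative.BudgetCeiling
import Summits.NavierStokesRegularity.NavierStokesRegularity.Theorems.RungReynoldsOne.Negative.WithoutLerayHopfFalse
import Literature.Analysis.FluidPDE.EnstrophyGronwall
import Literature.Analysis.FluidPDE.LerayH1ContinuationProofs
import Literature.Analysis.FluidPDE.KNSSTypeIIHolds
import Literature.Analysis.FluidPDE.TaoBoundedEnstrophyLerayH1
import Literature.Analysis.FluidPDE.TaoLocalisationHolds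
import Literature.Analysis.FluidPDE.CheskidovShvydkoyRegularProofs
import Literature.Analysis.FluidPDE.TaoFiniteEnergyLerayHopf
import HarnessLib.Audit

/-!
# Line `enstrophy-threshold-slack` — crux `RungReynoldsOne` (stmt-NavierStokesRegularity-2882)

Checked skeleton (crux-plan, round 1) for the crux idea
`Cruxes/RungReynoldsOne/Ideas/enstrophy-threshold-slack.md` of route `TypeICertificateLadder`
(rung `X_1`: no finite-energy classical Schwartz-datum solution blows up at `T` with collapse
Reynolds number `√((T−t)/ν)‖u(t)‖_∞ ≤ 1`).

## The line in one paragraph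

Enstrophy balance for a classical solution: `d/dt ‖∇u‖₂² = 2∫⟪(u·∇)u, Δu⟫ − 2ν‖Δu‖₂²` (the
pressure drops out). The only lossy step of the classical `(2, ∞)` Serrin–Grönwall estimate
(tree: `lintegral_frobeniusNormSq_fderiv_le_mul_exp`, Lemarié-Rieusset 2016 Thm. 11.2 (11.9)) is
Hölder `∫⟪(u·∇)u, Δu⟫ ≤ ‖u‖_∞‖∇u‖₂‖Δu‖₂`, taken with constant ONE. Writing `θ*` for the sharp
constant of this scale- and amplitude-invariant trilinear inequality over bounded divergence-free
fields (`HolderYoungSlackAt θ`), Young gives `d/dt‖∇u‖² ≤ θ*²‖u‖²_∞‖∇u‖²/(2ν)`; under the rung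
hypothesis `‖u(t)‖²_∞ ≤ C²ν/(T−t)` the enstrophy therefore grows at most like
`(T−t)^{-(θ* C)²/2 - o(1)}` (`SlackSlabGronwall` + `SlabBoundGivesDecay`), while at a genuine
blow-up time Leray's `H¹` lifespan `cν³/‖∇u‖⁴` forces `‖∇u(t)‖² ≥ √c ν^{3/2}(T−t)^{-1/2}`
(`LerayH1BlowupRate`). The exponents are incompatible as soon as `θ* C < 1`: every rung
`C < 1/θ*` follows (`rung_of_slack`), in particular the crux for ANY `θ* < 1`
(`RungReynoldsOne_of`). Numerically `θ* ≈ 0.14` (three independent codes, kit j005781/j006249/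
j006632, j013312, j013320; `Cruxes/RungReynoldsOne/ThetaStarNumerics.md`), a factor-7 margin.

## Stubs (4, registered by `ledger skeleton check`)

* `stub_holderYoungSlack` (HARDEST, the card proper, open): `∃ θ < 1` with the trilinear slack
  inequality on bounded `C²` divergence-free fields of `ℝ³` with `∇v, D²v ∈ L²`.
* `stub_slackSlabGronwall` (M): slack at `θ` ⇒ the slab enstrophy inequality of the tree with
  `exp(θ²M²s/(2ν))` in place of `exp(M²s/(2ν))` (same class: Tao's `H^k` solutions on `[0,T]`).
* `stub_slabBoundGivesDecay` (M–L): the slab inequality at `θ` ⇒ along every classical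
  Leray–Hopf Schwartz-datum solution with eventual rate `√(T−t)‖u‖ ≤ C√ν`, the weak dissipation
  `‖∇u(t)‖₂²` is `≤ K (T−t)^{-γ}` near `T` for every `γ > (θC)²/2` (Tao-class patches + geometric
  partition of `[t₀, T)`).
* `stub_lerayH1BlowupRate` (M): no classical extension past `T` ⇒ `cν³ ≤ ‖∇u(s)‖₂⁴ (T−s)` at
  every good restarting time `s` (Leray 1934 §20; RRS 2016 Lemma 6.11 / Thm. 6.15 + weak–strong
  uniqueness; template: `hasSmoothExtensionPast_of_bounded_of_local_H1_theory`).

`rung_one_of_stubs : HolderYoungSlack → SlackSlabGronwall → SlabBoundGivesDecay →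
LerayH1BlowupRate → Rung 1` is proved below without `sorry` (exponent bookkeeping + choice of a
good restarting time in the common eventual set; `Rung 1 ↔ RungReynoldsOne` is `rung_one_iff`),
and `RungReynoldsOne_of : RungReynoldsOne` — the one theorem concluding the crux BY NAME — is that
composition with the four registered stubs plugged in (its only gaps are their `sorry`s; it is
the crux proof the moment they land). (The stub statements are plain named `Prop`s: the
`@[stub]` tag is gate-reserved in crux work files.)

## Disproof.lean (gen 2) honoured

* `rungReynoldsOne_false_without_LerayHopf`, `rung_false_with_weak_for_LerayHopf` (landed:
  `Theorems/RungReynoldsOne/Negative/WithoutLerayHopfFalse.lean`, imported here): the ENERGY CLASS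
  is used in `stub_lerayH1BlowupRate` (datum `u(s) ∈ L²` for Leray's local strong solution and
  Prodi–Serrin weak–strong uniqueness) and in `stub_slabBoundGivesDecay` (finite energy puts the
  classical solution in Tao's class on closed sub-slabs); the parasitic drifts `u = g(t)e₀` have
  `∇u ≡ 0`, so `LerayH1BlowupRate` is exactly the statement they violate.
* `rungReynoldsOne_false_without_classical`: classical smoothness is used for the enstrophy
  identity (S2a), the Tao-class identification (S2b) and the pointwise gluing (S3).
* `budgetCloses_two_iff` / `enstrophy_budget_saturated` (landed: `Negative/BudgetCeiling.lean`,
  imported): with Hölder constant `1` the `q = 2` budget reaches exactly `C < 1` and is tight at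
  the crux; this line changes the CONSTANT, and `budgetCloses_two_slack_iff` below records that
  the same bookkeeping with `θ` reaches exactly `θC < 1`.
-/

noncomputable section

namespace Summit.NavierStokesRegularity.NavierStokesRegularity.Cruxes.RungReynoldsOne.EnstrophyThresholdSlack

open Set Filter Topology MeasureTheory
open scoped RealInnerProductSpace ENNReal NNReal Laplacian
open Literature.Analysis.FluidPDE
open Summit.NavierStokesRegularity.NavierStokesRegularity.Theses.TypeICertificateLadder

local notation "ℝ³" => EuclideanSpace ℝ (Fin 3)

/-! ## The rung template (shape of `LadderGlue` / `Assembly`; `Rung 1 ↔ RungReynoldsOne`) -/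

/-- Rung `X_C` of the ladder, verbatim the antecedent shape of `LadderGlue`. -/
def Rung (C : ℝ) : Prop :=
  ∀ (ν T : ℝ), 0 < ν → 0 < T → ∀ (u : ℝ → ℝ³ → ℝ³) (p : ℝ → ℝ³ → ℝ),
    IsClassicalNSSolutionOn (Set.Ico 0 T) ν 0 u p → IsLerayHopfOn T ν 0 (u 0) u →
    HasRapidSpatialDecay (u 0) →
    (∀ᶠ t in 𝓝[<] T, ∀ x, Real.sqrt (T - t) * ‖u t x‖ ≤ C * Real.sqrt ν) →
    HasSmoothExtensionPast ν 0 u T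

/-- The crux is literally rung one. -/
theorem rung_one_iff : Rung 1 ↔ RungReynoldsOne := by
  simp only [Rung, RungReynoldsOne, one_mul]

/-! ## Stub statements (named `Prop`s; the registered stubs `stub_*` below assert them) -/

/-- The scale- and amplitude-invariant TRILINEAR SLACK INEQUALITY with constant `θ`: for every
bounded `C²` divergence-free field `v` on `ℝ³` with `|v| ≤ M`, `∇v ∈ L²` and `D²v ∈ L²`,
`∫ ⟪(v·∇)v, Δv⟫ ≤ θ · M · ‖∇v‖₂ · ‖Δv‖₂`. With `θ = 1` this is Hölder (pointwise
`|(v·∇)v| ≤ |v|·|∇v|_F`) + Cauchy–Schwarz; `θ* := inf {θ : HolderYoungSlackAt θ}` is the sharp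
constant of enstrophy production normalised by the sup norm (numerically `θ* ≈ 0.14`,
`ThetaStarNumerics.md`). The left side is invariant under `v ↦ v + const` (skew-symmetry of
transport), so only the Chebyshev radius of the range of `v` matters; one-sided and two-sided
suprema agree (`v ↦ −v`). -/
def HolderYoungSlackAt (θ : ℝ) : Prop :=
  ∀ (M : ℝ) (v : ℝ³ → ℝ³), 0 ≤ M → ContDiff ℝ 2 v → VectorCalculus.IsDivFree v →
    (∀ x, ‖v x‖ ≤ M) →
    (∫⁻ x, ENNReal.ofReal (frobeniusNormSq (fderiv ℝ v x)) < ∞) →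
    (∫⁻ x, ‖iteratedFDeriv ℝ 2 v x‖ₑ ^ 2 < ∞) →
    ∫ x, ⟪convect v v x, Δ v x⟫ ≤
      θ * M * Real.sqrt (∫ x, frobeniusNormSq (fderiv ℝ v x)) * Real.sqrt (∫ x, ‖Δ v x‖ ^ 2)

/-- **Stub S1 (hardest; the card proper).** `θ* < 1`: the trilinear slack inequality holds with
SOME constant `θ < 1`. Open; credible: every pointwise-saturating gradient is rank one and
traceless, hence carries zero production density (triage r1-1 Scratch ex. 2, r1-3), two-scale
and Beltrami/sheet/tube ansätze give ratios `≲ ℓ/L` or `0`, and three independent optimisers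
over divergence-free trigonometric polynomials find nothing above `0.143`. Sources: Lu–Doering
2008 (Indiana Univ. Math. J. 57, enstrophy-production extremals), Lemarié-Rieusset 2016 Thm. 11.2,
`ThetaStarNumerics.md`, kit j013312 / j013320. -/
def HolderYoungSlack : Prop :=
  ∃ θ : ℝ, 0 < θ ∧ θ < 1 ∧ HolderYoungSlackAt θ

/-- The SLAB ENSTROPHY INEQUALITY with factor `θ²`: the conclusion of the tree theorem
`lintegral_frobeniusNormSq_fderiv_le_mul_exp` (Lemarié-Rieusset 2016, Thm. 11.2 (11.11); class:
classical solutions on `[0, T] × ℝ³` with `u, ∂ₜu, p ∈ L^∞_t H^k_x`, Tao 2013 Thm. 5.4) with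
`exp (θ² M² s / (2ν))` in place of `exp (M² s / (2ν))`. -/
def SlabEnstrophyBound (θ : ℝ) : Prop :=
  ∀ ⦃ν T : ℝ⦄, 0 < ν → 0 < T → ∀ ⦃u : ℝ → ℝ³ → ℝ³⦄ ⦃p : ℝ → ℝ³ → ℝ⦄,
    IsClassicalNSSolutionOn (Icc 0 T) ν 0 u p →
    HasBoundedSobolevNormsOn (Icc 0 T) u →
    HasBoundedSobolevNormsOn (Icc 0 T) (timeDerivWithin (Icc 0 T) u) →
    (∀ n : ℕ, ∃ C : ℝ≥0, ∀ t ∈ Icc 0 T, ∫⁻ x, ‖iteratedFDeriv ℝ n (p t) x‖ₑ ^ 2 ≤ C) →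
    ∀ ⦃M s : ℝ⦄, 0 < M → s ∈ Ioc 0 T → (∀ t ∈ Icc 0 s, ∀ x, ‖u t x‖ ≤ M) →
      ∫⁻ x, ENNReal.ofReal (frobeniusNormSq (fderiv ℝ (u s) x)) ≤
        ENNReal.ofReal (Real.exp (θ ^ 2 * M ^ 2 * s / (2 * ν))) *
          ∫⁻ x, ENNReal.ofReal (frobeniusNormSq (fderiv ℝ (u 0) x))

/-- **Stub S2a.** Slack at `θ` improves the Grönwall EXPONENT losslessly: re-run the proof of
`lintegral_frobeniusNormSq_fderiv_le_mul_exp` with the slice bound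
`∫Σᵢ⟪∂ᵢu, ∂ᵢ∂ₜu⟫ = −ν‖Δu‖² + ∫⟪(u·∇)u, Δu⟫ + ∫⟪Δu, ∇p⟫`, the pressure term vanishing
(`div Δu = 0`, `D³u, ∇p ∈ L²` in the class), the production bounded by `θM‖∇u‖‖Δu‖`
(`HolderYoungSlackAt θ` applied to the slice, which is bounded, `C^∞`, divergence free with all
Sobolev norms finite) and Young `2θM a b − 2ν b² ≤ θ²M²a²/(2ν)`. Sources: LemarieRieusset2016
Thm. 11.2 (11.9)–(11.11); tree `integral_sum_inner_fderiv_le_of_momentum`. -/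
def SlackSlabGronwall : Prop :=
  ∀ θ : ℝ, 0 < θ → HolderYoungSlackAt θ → SlabEnstrophyBound θ

/-- **Stub S2b.** The slab inequality at `θ` ⇒ ENSTROPHY GROWTH RATE along rate-`C` solutions:
for a classical solution on `ℝ³ × [0, T)`, Leray–Hopf from its rapidly decaying datum, with
eventual rate `√(T−t)‖u(t,x)‖ ≤ C√ν`, and every `γ > (θC)²/2`, the weak dissipation
`‖∇u(t)‖₂² = eWeakGradL2Sq (u t)` is `≤ K (T−t)^{−γ}` for all `t < T` near `T`. Proof route (all
inputs proved in the tree): on each closed sub-slab `[0, t₁]` the solution has bounded Sobolev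
norms (`tao2011_hasBoundedSobolevNormsOn_holds`, finite energy from the Leray–Hopf class) and is
bounded; restart at times `t' ≥ t₀` (rate in force) with Tao's local `H¹` solutions
(`tao2011_smooth_local_existence_holds`, which carry the `∂ₜu`- and `p`-bounds the slab
inequality wants; or `leray_local_regular_H1_holds`, same bounds on `[δ, τ]`), identified with
`u` by `eq_restart_of_serrin` (`serrin_weak_strong_uniqueness_holds`; good restarting times from
`IsLerayHopfOn.ae_isLerayHopfOn_translate` or `isLerayHopfOn_translate_of_finiteEnergy`); apply
`SlabEnstrophyBound θ` on the patches of a geometric partition `T − t_k = (T−t₀)q^k` with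
`M_k² = C²ν/(T−t_{k+1})`, so that `Σ_k θ²M_k²(t_{k+1}−t_k)/(2ν) = k·(θC)²(1−q)/(2q)` and
`‖∇u(t_k)‖² ≤ ‖∇u(t₀)‖²((T−t₀)/(T−t_k))^{(θC)²(1−q)/(2q|log q|)}`, exponent `↓ (θC)²/2` as
`q ↑ 1`; `eWeakGradL2Sq (u t) = ∫⁻|∇u(t)|²` for `C¹` slices
(`eWeakGradL2Sq_eq_of_hasWeakGradient (hasWeakGradient_fderiv_of_contDiff _)`). Sources: Tao 2013
(arXiv:1108.1165) Thm. 5.4, Cor. 11.1; RobinsonRodrigoSadowski2016 Lemma 6.11. -/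
def SlabBoundGivesDecay : Prop :=
  ∀ θ : ℝ, 0 < θ → SlabEnstrophyBound θ →
  ∀ (C γ : ℝ), 0 < C → (θ * C) ^ 2 / 2 < γ →
  ∀ (ν T : ℝ), 0 < ν → 0 < T → ∀ (u : ℝ → ℝ³ → ℝ³) (p : ℝ → ℝ³ → ℝ),
    IsClassicalNSSolutionOn (Set.Ico 0 T) ν 0 u p → IsLerayHopfOn T ν 0 (u 0) u →
    HasRapidSpatialDecay (u 0) →
    (∀ᶠ t in 𝓝[<] T, ∀ x, Real.sqrt (T - t) * ‖u t x‖ ≤ C * Real.sqrt ν) →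
    ∃ K : ℝ, 0 ≤ K ∧ ∀ᶠ t in 𝓝[<] T, eWeakGradL2Sq (u t) ≤ ENNReal.ofReal (K * (T - t) ^ (-γ))

/-- **Stub S3.** LERAY'S `H¹` BLOW-UP RATE (Leray 1934 §20; Robinson–Rodrigo–Sadowski 2016,
Lemma 6.11 with Thm. 6.15 and (8.2): `‖∇u(t)‖⁴ (T−t) ≥ cν³` before a singular time): there is a
universal `c > 0` such that if a classical solution on `ℝ³ × [0, T)`, Leray–Hopf on `[0, T)` from
`u 0`, has NO classical extension past `T`, then at every good restarting time `s ∈ (0, T)`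
(energy inequality from `s`) `c ν³ ≤ (‖∇u(s)‖₂²)² (T − s)` — in `ℝ≥0∞`, with
`‖∇u(s)‖₂² := eWeakGradL2Sq (u s)` (`= ∞` allowed). Proof route (inputs proved): if
`A²(T−s) < cν³`, `A = ‖∇u(s)‖₂²`, Leray's local REGULAR solution from `u(s) ∈ H¹`
(`leray_local_regular_H1_holds`, `LerayLocalRegularH1Proofs.lean`: lifespan `cν³/A²` beyond
`T − s`, Leray–Hopf from `u(s)`, `H¹`-regular, classical on `(0, τ]`; alternatively
`leray_local_strong_H1_holds` + `ladyzhenskaya_prodi_serrin_holds`) coincides with `u(· + s)` on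
`[0, T−s)` by `serrin_weak_strong_uniqueness_holds` (Serrin class `L^∞_t L⁶_x`,
`memLqLp_top_six_of_isH1RegularOn_Icc`), the continuous slices then agree everywhere, and
`IsClassicalNSSolutionOn.glue` extends `u` past `T` — template: the second half of
`hasSmoothExtensionPast_of_bounded_of_local_H1_theory` (KNSSTypeIIContinuation.lean). This is
where the ENERGY CLASS is load-bearing (`rungReynoldsOne_false_without_LerayHopf`: the drifts
have `∇u ≡ 0`). -/
def LerayH1BlowupRate : Prop :=
  ∃ c : ℝ, 0 < c ∧ ∀ (ν T : ℝ), 0 < ν → 0 < T → ∀ (u : ℝ → ℝ³ → ℝ³) (p : ℝ → ℝ³ → ℝ),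
    IsClassicalNSSolutionOn (Set.Ico 0 T) ν 0 u p → IsLerayHopfOn T ν 0 (u 0) u →
    ¬ HasSmoothExtensionPast ν 0 u T →
    ∀ s ∈ Ioo 0 T, IsLerayHopfOn (T - s) ν 0 (u s) (fun t => u (t + s)) →
      ENNReal.ofReal (c * ν ^ 3) ≤ eWeakGradL2Sq (u s) ^ 2 * ENNReal.ofReal (T - s)

/-! ## Registered stubs -/

/-- S1 — `θ* < 1` (hardest). -/
theorem stub_holderYoungSlack : HolderYoungSlack := by
  sorry

/-- S2a — slack `θ` ⇒ slab enstrophy inequality with factor `θ²`. -/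
theorem stub_slackSlabGronwall : SlackSlabGronwall := by
  sorry

/-- S2b — slab inequality ⇒ growth exponent `(θC)²/2 + o(1)` along rate-`C` solutions. -/
theorem stub_slabBoundGivesDecay : SlabBoundGivesDecay := by
  sorry

/-- S3 — Leray's `H¹` blow-up rate at a time with no classical extension. -/
theorem stub_lerayH1BlowupRate : LerayH1BlowupRate := by
  sorry

/-! ## Bookkeeping lemmas (proved) -/

/-- The `q = 2` budget bookkeeping of `Negative/BudgetCeiling.lean` with the Hölder constant `θ`
in place of `1`: it closes rung `C` iff `θ C < 1` (for `θ = 1` this is the landed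
`budgetCloses_two_iff`: exactly the rungs `C < 1`). -/
theorem budgetCloses_two_slack_iff {θ C : ℝ} (hθ : 0 ≤ θ) (hC : 0 ≤ C) :
    (2 * (2 - 1) * (θ * C) ^ 2 / 4 < 2 - 3 / 2) ↔ θ * C < 1 :=
  Summit.NavierStokesRegularity.NavierStokesRegularity.Theorems.RungReynoldsOneNegative.budgetCloses_two_iff
    (mul_nonneg hθ hC)

/-- Exponent arithmetic: `(K x^{-γ})² · x = K² x^{1 − 2γ}` for `x > 0`. -/
theorem sq_mul_rpow_neg_mul {x : ℝ} (hx : 0 < x) (K γ : ℝ) :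
    (K * x ^ (-γ)) ^ 2 * x = K ^ 2 * x ^ (1 - 2 * γ) := by
  have h1 : (x ^ (-γ)) ^ 2 = x ^ (-γ * 2) := by
    rw [← Real.rpow_two, ← Real.rpow_mul hx.le]
  have h2 : x ^ (-γ * 2) * x = x ^ (1 - 2 * γ) := by
    conv_lhs => rw [← Real.rpow_one x, ← Real.rpow_mul hx.le, ← Real.rpow_add hx]
    congr 1
    ring
  rw [mul_pow, h1, mul_assoc, h2]

/-- `K² (T − t)^{1−2γ} → 0` as `t ↑ T` when `γ < 1/2`. -/
theorem tendsto_sq_mul_rpow_sub {T K γ : ℝ} (hγ : γ < 1 / 2) :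
    Tendsto (fun t : ℝ => K ^ 2 * (T - t) ^ (1 - 2 * γ)) (𝓝[<] T) (𝓝 0) := by
  have hpos : 0 < 1 - 2 * γ := by linarith
  have h1 : Tendsto (fun t : ℝ => T - t) (𝓝[<] T) (𝓝 0) := by
    have h : Tendsto (fun t : ℝ => T - t) (𝓝 T) (𝓝 (T - T)) :=
      tendsto_const_nhds.sub tendsto_id
    rw [sub_self] at h
    exact h.mono_left nhdsWithin_le_nhds
  have h2 : Tendsto (fun t : ℝ => (T - t) ^ (1 - 2 * γ)) (𝓝[<] T) (𝓝 0) := by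
    have h := h1.rpow_const (p := 1 - 2 * γ) (Or.inr hpos.le)
    rwa [Real.zero_rpow hpos.ne'] at h
  simpa using h2.const_mul (K ^ 2)

/-! ## The composition: slack `θ` with `θC < 1` closes rung `C`; `θ* < 1` closes the crux -/

/-- **Every rung `C < 1/θ` falls to slack `θ`.** From S2a, S2b, S3: if the trilinear inequality
holds with constant `θ` and `θ C < 1`, then rung `X_C` holds. Proof: with
`γ := ((θC)² + 1)/4 ∈ ((θC)²/2, 1/2)`, S2a+S2b bound `‖∇u(t)‖₂² ≤ K(T−t)^{−γ}` near `T`; if `u`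
did not extend, S3 would give `cν³ ≤ K²(T−s)^{1−2γ}` at good restarting times `s` arbitrarily
close to `T` (`IsLerayHopfOn.exists_isLerayHopfOn_restart_Ioo`), but the right side tends to `0`. -/
theorem rung_of_slack (h₂ : SlackSlabGronwall) (h₃ : SlabBoundGivesDecay) (h₄ : LerayH1BlowupRate)
    {θ C : ℝ} (hθ : 0 < θ) (hslack : HolderYoungSlackAt θ) (hC : 0 < C) (hθC : θ * C < 1) :
    Rung C := by
  intro ν T hν hT u p hcl hLH hdec hrate
  by_contra hext
  -- the exponent
  set γ : ℝ := ((θ * C) ^ 2 + 1) / 4 with hγ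
  have hθC0 : 0 ≤ θ * C := by positivity
  have hθC2 : (θ * C) ^ 2 < 1 := by nlinarith
  have hγlo : (θ * C) ^ 2 / 2 < γ := by rw [hγ]; linarith
  have hγhi : γ < 1 / 2 := by rw [hγ]; linarith
  -- upper bound on the enstrophy near `T`
  obtain ⟨K, hK0, hup⟩ :=
    h₃ θ hθ (h₂ θ hθ hslack) C γ hC hγlo ν T hν hT u p hcl hLH hdec hrate
  -- Leray's lower bound at good restarting times
  obtain ⟨c, hc, hlow⟩ := h₄
  have hlow' := hlow ν T hν hT u p hcl hLH hext
  have hcν : 0 < c * ν ^ 3 := mul_pos hc (pow_pos hν 3)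
  -- eventually `K² (T − t)^{1−2γ} < c ν³`
  have hsmall : ∀ᶠ t in 𝓝[<] T, K ^ 2 * (T - t) ^ (1 - 2 * γ) < c * ν ^ 3 :=
    (tendsto_order.1 (tendsto_sq_mul_rpow_sub (T := T) (K := K) hγhi)).2 _ hcν
  obtain ⟨a, haT, hsub⟩ := mem_nhdsLT_iff_exists_Ioo_subset.1 (hup.and hsmall)
  -- a good restarting time `s ∈ (max a 0, T)`
  have ha'T : max a 0 < T := max_lt haT hT
  obtain ⟨s, hs, hLHs⟩ := hLH.exists_isLerayHopfOn_restart_Ioo hν.le (le_max_right a 0) ha'T le_rfl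
  have hsa : s ∈ Ioo a T := ⟨(le_max_left _ _).trans_lt hs.1, hs.2⟩
  have hs0 : s ∈ Ioo 0 T := ⟨(le_max_right _ _).trans_lt hs.1, hs.2⟩
  obtain ⟨hupS, hsmallS⟩ := hsub hsa
  have hlowS := hlow' s hs0 hLHs
  have hTs : 0 < T - s := sub_pos.2 hs.2
  -- combine
  have hnn : 0 ≤ K * (T - s) ^ (-γ) := mul_nonneg hK0 (Real.rpow_nonneg hTs.le _)
  have hchain : ENNReal.ofReal (c * ν ^ 3) ≤ ENNReal.ofReal (K ^ 2 * (T - s) ^ (1 - 2 * γ)) := by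
    calc ENNReal.ofReal (c * ν ^ 3)
        ≤ eWeakGradL2Sq (u s) ^ 2 * ENNReal.ofReal (T - s) := hlowS
      _ ≤ (ENNReal.ofReal (K * (T - s) ^ (-γ))) ^ 2 * ENNReal.ofReal (T - s) := by
          gcongr
      _ = ENNReal.ofReal ((K * (T - s) ^ (-γ)) ^ 2 * (T - s)) := by
          rw [ENNReal.ofReal_mul (sq_nonneg _), ENNReal.ofReal_pow hnn]
      _ = ENNReal.ofReal (K ^ 2 * (T - s) ^ (1 - 2 * γ)) := by
          rw [sq_mul_rpow_neg_mul hTs]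
  have hnn' : 0 ≤ K ^ 2 * (T - s) ^ (1 - 2 * γ) :=
    mul_nonneg (sq_nonneg _) (Real.rpow_nonneg hTs.le _)
  have := (ENNReal.ofReal_le_ofReal_iff hnn').1 hchain
  linarith

/-- **`θ* < 1` closes rung one** — the honest shape `Stub₁ → Stub₂ → Stub₃ → Stub₄ → X_1`
(hypotheses exactly the four stub statements; `Rung 1 ↔ RungReynoldsOne` by `rung_one_iff`). -/
theorem rung_one_of_stubs (h₁ : HolderYoungSlack) (h₂ : SlackSlabGronwall)
    (h₃ : SlabBoundGivesDecay) (h₄ : LerayH1BlowupRate) : Rung 1 := by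
  obtain ⟨θ, hθ, hθ1, hslack⟩ := h₁
  exact rung_of_slack h₂ h₃ h₄ hθ hslack one_pos (by simpa using hθ1)

/-- **The composition (kernel-checked), concluding the crux decl BY NAME**: `rung_one_of_stubs`
with the four registered stubs plugged in. No `sorry` of its own; its closure is the crux proof
as soon as `stub_holderYoungSlack`, `stub_slackSlabGronwall`, `stub_slabBoundGivesDecay`,
`stub_lerayH1BlowupRate` are proved with these exact statements. -/
theorem RungReynoldsOne_of : RungReynoldsOne :=
  rung_one_iff.1 (rung_one_of_stubs stub_holderYoungSlack stub_slackSlabGronwall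
    stub_slabBoundGivesDecay stub_lerayH1BlowupRate)

/-- By-product for the ladder (tenure rungs `C = 2, 5, …`): slack `θ` closes EVERY rung
`C < 1/θ` — the input of `LadderGlue` restricted to `C < 1/θ`. -/
theorem rungs_below_inv_slack (h₂ : SlackSlabGronwall) (h₃ : SlabBoundGivesDecay)
    (h₄ : LerayH1BlowupRate) {θ : ℝ} (hθ : 0 < θ) (hslack : HolderYoungSlackAt θ) :
    ∀ C : ℝ, 0 < C → C < θ⁻¹ → Rung C := fun C hC hCθ =>
  rung_of_slack h₂ h₃ h₄ hθ hslack hC (by rwa [lt_inv_comm₀ hC hθ, inv_eq_one_div,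
    lt_div_iff₀ hC] at hCθ)

end Summit.NavierStokesRegularity.NavierStokesRegularity.Cruxes.RungReynoldsOne.EnstrophyThresholdSlack

end
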